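import Literature.NumberTheory.Automorphic.CompletedCohomology
import HarnessLib

/-!
# Torsion eigenclasses give points of the big Hecke algebra

Topic `NumberTheory/Automorphic`, namespace `Literature.NumberTheory.Automorphic`.

We relate the two "occurrence" notions of `CompletedCohomology` for a system of Hecke eigenvalues
`χ : J → k` in the completed cohomology of a tower `T` (Hecke elements `δ : J → 𝒢`, coefficients
`k/ϖ^t`):

* `towerCohomology.directedSystem`: the pull-back system of a tower is a `DirectedSystem`
  (so Mathlib's `Module.DirectLimit` exactness lemmas apply to `completedCohomologyMod`);
* `exists_smul_of_mem_bigHeckeAlgebra`: on a simultaneous eigenclass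
  `c ∈ H^i(X_{K(s)}, k/ϖ^t)` every element of the big Hecke algebra `𝕋(Kᵖ)` acts (through its
  `(i,s,t)`-component) by a scalar;
* `IsHeckeEigenclass.exists_algHom`: if moreover the annihilator of `c` in `k` is exactly `(ϖ^t)`,
  then `x ↦ (the scalar by which x acts on c) mod ϖ^t` is a well-defined continuous `k`-algebra
  homomorphism `𝕋(Kᵖ) → k/ϖ^t` sending `T_{δ j} ↦ χ j`;
* `EigensystemOccurs.isHeckePoint`: hence a system of eigenvalues occurring in completed cohomology
  in the torsion-eigenclass sense (`EigensystemOccurs`) is a point of `Spf 𝕋(Kᵖ)` in the sense of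
  `IsHeckePoint`.

This is the elementary half of the dictionary "systems of Hecke eigenvalues in `H̃^•` ↔ points of
`Spec`/`Spf 𝕋`" of [CalegariEmerton2011, §8] (there for characteristic-`0` eigenforms via the
Hochschild–Serre spectral sequence); the converse direction requires more commutative algebra and
is not attempted here.

## References

* F. Calegari, M. Emerton, *Completed cohomology — a survey* (2012), §8 [CalegariEmerton2011].
-/

noncomputable section

universe u v

namespace Literature.NumberTheory.Automorphic

variable {k : Type u} [CommRing k] {Γ 𝒢 : Type u} [Group Γ] [Group 𝒢]
variable {ι : Γ →* 𝒢} {T : LevelTower 𝒢} {ϖ : k} {J : Type v} {δ : J → 𝒢} {χ : J → k}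

/-- The direct system `s ↦ H^i(X_{K(s)}, k/ϖ^t)` of a tower along the pull-backs is a directed
system in Mathlib's sense (identities and composition: `cohomologyPullback_refl`,
`cohomologyPullback_comp`), so that `Module.DirectLimit.of.zero_exact`, `exists_of` etc. apply to
`completedCohomologyMod`. [folklore] -/
instance towerCohomology.directedSystem (i t : ℕ) :
    DirectedSystem (fun s => towerCohomology k ι T ϖ i s t)
      (fun _ _ h => towerTransition k ι T ϖ i t _ _ h) where
  map_self _ x := by
    change (towerPullback k ι T ϖ i t le_rfl).hom x = x
    rw [towerPullback, ArithmeticQuotient.cohomologyPullback_refl]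
    rfl
  map_map _ _ _ h₁ h₂ x := by
    change (towerPullback k ι T ϖ i t h₂).hom ((towerPullback k ι T ϖ i t h₁).hom x) = _
    rw [← ModuleCat.comp_apply, towerPullback, towerPullback,
      ArithmeticQuotient.cohomologyPullback_comp]

/-- On a simultaneous Hecke eigenclass `c ∈ H^i(X_{K(s)}, k/ϖ^t)`, every element of the (dense)
Hecke algebra `towerHeckeAlgebra` acts through its `(i,s,t)`-component by a scalar. [folklore] -/
theorem exists_smul_of_mem_towerHeckeAlgebra {i s t : ℕ} {c : towerCohomology k ι T ϖ i s t}
    (hc : ArithmeticQuotient.IsHeckeEigenclass ι (T.level s) (modPow k ϖ t) δ χ i c)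
    {a : towerEndProd k ι T ϖ} (ha : a ∈ towerHeckeAlgebra k ι T ϖ δ) :
    ∃ r : k, a (i, s, t) c = r • c := by
  refine Algebra.adjoin_induction (fun a ha => ?_) (fun r => ⟨r, ?_⟩) (fun a b _ _ ha hb => ?_)
    (fun a b _ _ ha hb => ?_) ha
  · obtain ⟨j, rfl⟩ := ha
    exact ⟨χ j, hc.2 j⟩
  · rw [Pi.algebraMap_apply, Module.algebraMap_end_apply]
  · obtain ⟨x, hx⟩ := ha
    obtain ⟨y, hy⟩ := hb
    exact ⟨x + y, by rw [Pi.add_apply, LinearMap.add_apply, hx, hy, add_smul]⟩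
  · obtain ⟨x, hx⟩ := ha
    obtain ⟨y, hy⟩ := hb
    exact ⟨y * x, by rw [Pi.mul_apply, Module.End.mul_apply, hy, map_smul, hx, mul_smul]⟩

/-- On a simultaneous Hecke eigenclass `c ∈ H^i(X_{K(s)}, k/ϖ^t)`, every element of the big Hecke
algebra `𝕋(Kᵖ)` acts through its `(i,s,t)`-component by a scalar. [folklore] -/
theorem exists_smul_of_mem_bigHeckeAlgebra {i s t : ℕ} {c : towerCohomology k ι T ϖ i s t}
    (hc : ArithmeticQuotient.IsHeckeEigenclass ι (T.level s) (modPow k ϖ t) δ χ i c)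
    {x : towerEndProd k ι T ϖ} (hx : x ∈ bigHeckeAlgebra k ι T ϖ δ) :
    ∃ r : k, x (i, s, t) c = r • c := by
  obtain ⟨a, ha, hxa⟩ := hx {(i, s, t)}
  rw [hxa (i, s, t) (Finset.mem_singleton_self _)]
  exact exists_smul_of_mem_towerHeckeAlgebra hc ha

/-- **A torsion eigenclass with exact annihilator defines a point of `𝕋(Kᵖ)` mod `ϖ^t`.**  If
`c ∈ H^i(X_{K(s)}, k/ϖ^t)` is a simultaneous eigenclass (`T_{δ j} c = χ j • c`) whose annihilator in
`k` is `(ϖ^t)`, there is a `k`-algebra homomorphism `φ : 𝕋(Kᵖ) → k/ϖ^t` with `x c = φ(x) c`, i.e.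
`φ x = a mod ϖ^t` whenever the `(i,s,t)`-component of `x` acts on `c` by `a`; it depends only on
that component (continuity) and sends `T_{δ j} ↦ χ j`. [cite: CalegariEmerton2011, §8] -/
theorem _root_.Literature.NumberTheory.Automorphic.ArithmeticQuotient.IsHeckeEigenclass.exists_algHom
    {i s t : ℕ} {c : towerCohomology k ι T ϖ i s t}
    (hc : ArithmeticQuotient.IsHeckeEigenclass ι (T.level s) (modPow k ϖ t) δ χ i c)
    (hann : ∀ a : k, a • c = 0 → a ∈ Ideal.span {ϖ ^ t}) :
    ∃ φ : bigHeckeAlgebra k ι T ϖ δ →ₐ[k] modPow k ϖ t,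
      (∀ x y : bigHeckeAlgebra k ι T ϖ δ, x.1 (i, s, t) = y.1 (i, s, t) → φ x = φ y) ∧
        ∀ (x : bigHeckeAlgebra k ι T ϖ δ) (a : k), x.1 (i, s, t) c = a • c →
          φ x = Ideal.Quotient.mk _ a := by
  have hex : ∀ x : bigHeckeAlgebra k ι T ϖ δ, ∃ r : k, x.1 (i, s, t) c = r • c :=
    fun x => exists_smul_of_mem_bigHeckeAlgebra hc x.2
  choose r hr using hex
  have hwd : ∀ (x : bigHeckeAlgebra k ι T ϖ δ) (a : k), x.1 (i, s, t) c = a • c →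
      Ideal.Quotient.mk (Ideal.span {ϖ ^ t}) (r x) = Ideal.Quotient.mk _ a := by
    intro x a ha
    rw [Ideal.Quotient.eq]
    apply hann
    rw [sub_smul, ← hr x, ← ha, sub_self]
  refine ⟨{ toFun := fun x => Ideal.Quotient.mk _ (r x)
            map_one' := (hwd 1 1 (by simp)).trans (map_one _)
            map_mul' := fun x y => ?_
            map_zero' := (hwd 0 0 (by simp)).trans (map_zero _)
            map_add' := fun x y => ?_
            commutes' := fun a => ?_ }, fun x y hxy => ?_, fun x a ha => hwd x a ha⟩
  · rw [← map_mul]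
    refine hwd (x * y) (r x * r y) ?_
    rw [Subalgebra.coe_mul, Pi.mul_apply, Module.End.mul_apply, hr y, map_smul, hr x, smul_smul,
      mul_comm]
  · rw [← map_add]
    refine hwd (x + y) (r x + r y) ?_
    rw [Subalgebra.coe_add, Pi.add_apply, LinearMap.add_apply, hr x, hr y, add_smul]
  · refine (hwd _ a ?_).trans rfl
    rw [Subalgebra.coe_algebraMap, Pi.algebraMap_apply, Module.algebraMap_end_apply]
  · change Ideal.Quotient.mk _ (r x) = Ideal.Quotient.mk _ (r y)
    exact hwd x (r y) (by rw [hxy]; exact hr y)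

/-- **Occurrence by torsion eigenclasses implies being a point of `Spf 𝕋(Kᵖ)`**: if the system of
eigenvalues `χ` occurs in the completed cohomology of the tower in degree `i` in the sense of
`EigensystemOccurs` (for every `t` an eigenclass in some `H^i(X_{K(s)}, k/ϖ^{t+1})` with exact
annihilator `(ϖ^{t+1})`), then `T_{δ j} ↦ χ j` extends to continuous `k`-algebra homomorphisms
`𝕋(Kᵖ) → k/ϖ^t` for all `t` (`IsHeckePoint`). [cite: CalegariEmerton2011, §8] -/
theorem EigensystemOccurs.isHeckePoint {i : ℕ} (h : EigensystemOccurs ι T ϖ δ χ i) :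
    IsHeckePoint ι T ϖ δ χ := by
  intro t
  cases t with
  | zero =>
    haveI : Subsingleton (modPow k ϖ 0) :=
      Ideal.Quotient.subsingleton_iff.mpr (by rw [pow_zero, Ideal.span_singleton_one])
    exact ⟨∅, { toFun := fun _ => 0
                map_one' := Subsingleton.elim _ _
                map_mul' := fun _ _ => Subsingleton.elim _ _
                map_zero' := Subsingleton.elim _ _
                map_add' := fun _ _ => Subsingleton.elim _ _
                commutes' := fun _ => Subsingleton.elim _ _ },
      fun _ _ _ => Subsingleton.elim _ _, fun _ => Subsingleton.elim _ _⟩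
  | succ t =>
    obtain ⟨s, c, hc, hann⟩ := h t
    obtain ⟨φ, hcont, hval⟩ := hc.exists_algHom hann
    exact ⟨{(i, s, t + 1)}, φ, fun x y hxy => hcont x y (hxy _ (Finset.mem_singleton_self _)),
      fun j => hval _ (χ j) (hc.2 j)⟩

end Literature.NumberTheory.Automorphic
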